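import Literature.AnabelianGeometry.SemiGraphs.Corollary27iConsequences
import HarnessLib

/-!
# [IUTchI] Prop 2.2, cited input `hHatH` — the named fact F-1458 REPLACED BY ITS KERNEL THEOREM

Mochizuki, *Inter-universal Teichmüller theory I*, kurims manuscript (May 2020), §2 p. 44 l. 24–31 and
Prop 2.2 proof p. 46 l. 9–11 («by the evident pro-Σ̂ analogue of [SemiAnbd], Corollary 2.7, (i) …, we have
C_{Π̂_𝔾}(Π̂_ℍ) = Π̂_ℍ») [claim: Mochizuki2012, status: disputed] (nothing of the series is asserted);
Mochizuki, *Semi-graphs of anabelioids* (2006), Cor 2.7 (i) p. 30 [cite: MochizukiSemiAnbd2006, Cor. 2.7(i) p.30]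
= FACT-LIST F-1458, now the kernel theorem `SemiGraphOfAnabelioids.corollary_2_7_i_holds`
(`Literature/AnabelianGeometry/SemiGraphs/Corollary27iHoldsViaDecompositionGroups.lean`, abc-iut-w4-d071; second
independent proof `Corollary27iHolds.lean`, abc-iut-w5-d041).

PROOF-ONLY (abc-iut cell; abc-iut-w5-d041 as (ASM) of the Cor 2.7 chain, twin-by-instantiation of
abc-iut-w5-d028's `TemperedCoveringsHatHOfCor27.lean`, no `def`, no new `Prop` fact; the `hHatH` input itself,
unconditional, is abc-iut-w4-d071's `TemperedGraphGroupData.hatH_commTerminal` in `Corollary27iConsequences.lean`):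
* `prop22_byName_of_cuspOmitted` — [IUTchI] Prop 2.2 AS TYPED (`CommensuratorsOfDecompositionSubgroups`) with the
  cited input `hHatH` supplied by the THEOREM [SemiAnbd] Cor 2.7 (i) + the agreement `eHat`/`hrange` + the p. 44
  atoms `hq`/`hel`; every other printed input stays BY NAME exactly as in `prop22_byName_of_corollary_2_7_i`.
GAP-LEDGER G-w5d028-1 disposition (i): the F-1458 dependence is GONE (kernel theorem); the remaining named
inputs are the agreement datum and the cusp-omission atoms.  HONEST FRAMING: no side taken on [IUTchIII]
Cor 3.12; typed ≠ proved for the remaining named inputs.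
-/

namespace Literature.IUT.HodgeTheaters

open CategoryTheory CategoryTheory.PreGaloisCategory
open Pointwise Topology
open Literature.AnabelianGeometry.SemiGraphs (IsProfiniteCompletion PSCDatum ProfiniteSemiGraph SemiGraphOfAnabelioids
  isCommensurablyTerminal_map_iff_of_bijective)
open Literature.AnabelianGeometry.SemiGraphs.ProfiniteSemiGraph (TemperedPiChart verticialSubgroups CompactInVerticial
  VerticialInjective)
open Literature.AnabelianGeometry.AbsoluteAnabelian (IsCommensurablyTerminal)

universe v₁ u₁ u' u

namespace TemperedGraphGroupData

variable (D : TemperedGraphGroupData.{u})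

variable {𝒢 𝒢H : ProfiniteSemiGraph.{u}}

/-- **[IUTchI] Prop 2.2 AS TYPED, with the cited input `hHatH` supplied by the kernel theorem
[SemiAnbd] Cor 2.7 (i)** (+ agreement + p. 44 atoms); all other printed inputs by name as in
abc-iut-w5-d028's `prop22_byName_of_corollary_2_7_i`. ([IUTchI] Prop 2.2 pp.45–46)
[claim: Mochizuki2012, status: disputed] [cite: MochizukiSemiAnbd2006, Cor. 2.7(i) p.30] -/
theorem prop22_byName_of_cuspOmitted [T2Space D.Tp] (hcH : IsClosed (D.HatH : Set D.Hat))
    -- the `𝔾`-datum, as in `prop21_byName`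
    (c : TemperedPiChart 𝒢) (e : D.Tp ≃ₜ* c.G) (h𝒢 : 𝒢.Thm37Hypotheses)
    (hCV : CompactInVerticial.{u}) (hVI : VerticialInjective.{u})
    (hPC : IsProfiniteCompletion
      ({ toMonoidHom := D.ι, continuous_toFun := D.ι_continuous } : D.Tp →ₜ* D.Hat))
    (hGal : ∀ S : ProfiniteSemiGraph.BTempCat 𝒢,
      Literature.AlgebraicGeometry.Frobenioids.IsConnectedObj S →
      ∃ (H : ProfiniteSemiGraph.BTempCat 𝒢) (_ : H ⟶ S),
        Literature.AnabelianGeometry.SemiGraphs.IsGaloisObj H ∧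
          Group.ResiduallyFinite (CategoryTheory.Aut H))
    (G : PSCDatum D.Hat) (hNN : G.VerticialIntersectionNear) (σ : 𝒢.graph.Vertex ≃ G.graph.V)
    (Λv : G.graph.V → Subgroup D.Tp)
    (hvert : ∀ v : 𝒢.graph.Vertex, (Λv (σ v)).map (e : D.Tp →* c.G) ∈ verticialSubgroups c v)
    (hΛv : ∀ v, (Λv v).map D.ι = G.vertGp v)
    (src tgt : G.graph.N → G.graph.V) (c₁ c₂ : G.graph.N → D.Tp)
    (hends : ∀ e, G.graph.nodeEnds e = s(src e, tgt e))
    (h₁ : ∀ e, G.nodeGp e ≤ MulAut.conj (D.ι (c₁ e)) • G.vertGp (src e))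
    (h₂ : ∀ e, G.nodeGp e ≤ MulAut.conj (D.ι (c₂ e)) • G.vertGp (tgt e))
    (hloop : ∀ e, src e = tgt e → (c₁ e)⁻¹ * c₂ e ∉ Λv (src e))
    -- the `ℍ`-datum `D.restrictH hcH`, likewise
    (cH : TemperedPiChart 𝒢H) (eH : (D.restrictH hcH).Tp ≃ₜ* cH.G) (h𝒢H : 𝒢H.Thm37Hypotheses)
    (hPCH : IsProfiniteCompletion
      ({ toMonoidHom := (D.restrictH hcH).ι, continuous_toFun := (D.restrictH hcH).ι_continuous } :
        (D.restrictH hcH).Tp →ₜ* (D.restrictH hcH).Hat))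
    (hGalH : ∀ S : ProfiniteSemiGraph.BTempCat 𝒢H,
      Literature.AlgebraicGeometry.Frobenioids.IsConnectedObj S →
      ∃ (H : ProfiniteSemiGraph.BTempCat 𝒢H) (_ : H ⟶ S),
        Literature.AnabelianGeometry.SemiGraphs.IsGaloisObj H ∧
          Group.ResiduallyFinite (CategoryTheory.Aut H))
    (GH : PSCDatum (D.restrictH hcH).Hat) (hNNH : GH.VerticialIntersectionNear)
    (σH : 𝒢H.graph.Vertex ≃ GH.graph.V)
    (ΛvH : GH.graph.V → Subgroup (D.restrictH hcH).Tp)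
    (hvertH : ∀ v : 𝒢H.graph.Vertex,
      (ΛvH (σH v)).map (eH : (D.restrictH hcH).Tp →* cH.G) ∈ verticialSubgroups cH v)
    (hΛvH : ∀ v, (ΛvH v).map (D.restrictH hcH).ι = GH.vertGp v)
    (srcH tgtH : GH.graph.N → GH.graph.V) (c₁H c₂H : GH.graph.N → (D.restrictH hcH).Tp)
    (hendsH : ∀ e, GH.graph.nodeEnds e = s(srcH e, tgtH e))
    (h₁H : ∀ e, GH.nodeGp e ≤ MulAut.conj ((D.restrictH hcH).ι (c₁H e)) • GH.vertGp (srcH e))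
    (h₂H : ∀ e, GH.nodeGp e ≤ MulAut.conj ((D.restrictH hcH).ι (c₂H e)) • GH.vertGp (tgtH e))
    (hloopH : ∀ e, srcH e = tgtH e → (c₁H e)⁻¹ * c₂H e ∉ ΛvH (srcH e))
    -- the cited input: the KERNEL THEOREM `corollary_2_7_i_holds` + agreement + p.44 atoms
    {𝒜 : SemiGraphOfAnabelioids.{v₁, u₁, u'}} (h𝒜 : 𝒜.IsConnected)
    (hq : (𝒜.restrict 𝒜.graph.maximalSubgraph).IsQuasiCoherent)
    (K : 𝒜.graph.Subgraph) (hK : K.toSemiGraph.IsConnected) (w : K.toSemiGraph.Vertex)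
    (hel : ∀ v : K.toSemiGraph.Vertex, (𝒜.restrict 𝒜.graph.maximalSubgraph).IsElevated ⟨v.1, trivial⟩)
    (F : 𝒜.V w.1 ⥤ FintypeCat.{v₁}) [FiberFunctor F]
    (eHat : D.Hat ≃* 𝒜.Pi w.1 F) (hrange : D.HatH.map eHat.toMonoidHom = (𝒜.piHToPi K w F).range) :
    D.CommensuratorsOfDecompositionSubgroups :=
  D.prop22_byName_of_corollary_2_7_i hcH c e h𝒢 hCV hVI hPC hGal G hNN σ Λv hvert hΛv src tgt c₁ c₂ hends
    h₁ h₂ hloop cH eH h𝒢H hPCH hGalH GH hNNH σH ΛvH hvertH hΛvH srcH tgtH c₁H c₂H hendsH h₁H h₂H hloopH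
    SemiGraphOfAnabelioids.corollary_2_7_i_holds h𝒜 hq K hK w hel F eHat hrange

end TemperedGraphGroupData

end Literature.IUT.HodgeTheaters
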